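import Summits.QuantumAdvantage.QuantumAdvantage.Theorems.CharDialPrefixFace
import HarnessLib

/-!
# The prefix face modulo the junta: forms that are prefix counters OFF the read bits (decomp-qadv lens-6 g16, tree part 29C)

A cut reading the junta `J_g` may carry ANY coefficients on the bits of `J_g` (they are absorbed into the table): if every form
`a_g` agrees with a prefix counter `t_g·𝟙_{[0,g)}` OUTSIDE `J_g`, the data re-presents as genuine prefix-counter data with the same
juntas and the same strategy (`PrefixFace.prefixify`, `prefixify_strat`), so part 29's bound applies verbatim:
`prefixFormModJunta_hard_unif` (every `p` with `p % 3 ≠ 0`; `_prime` for primes `p ≠ 3`).  Kernel-closed.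
-/

set_option linter.dupNamespace false
set_option autoImplicit false

namespace Summit.QuantumAdvantage.AdviceFreeQNC0.JLinPeel

open Finset AffBells22

namespace PrefixFace

variable {p n : ℕ}

/-- re-presentation of data whose forms are prefix counters off the junta: same juntas, genuine prefix-counter forms
`t_g·𝟙_{[0,g)}`, tables corrected by the junta-supported difference `Σ_{i ∈ J_g, u_i} (a_g i − t_g·[i<g])`. -/
def prefixify (D : JLinData p n) (t : Fin (n + 1) → ZMod p) : JLinData p n where
  J := D.J
  a := fun g i => if i.val < g.val then t g else 0
  h := fun g u s => D.h g u (s + ∑ i ∈ D.J g, if u i then (D.a g i - (if i.val < g.val then t g else 0)) else 0)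
  hJ := by
    intro g u v huv s
    have hc : (∑ i ∈ D.J g, if u i then (D.a g i - (if i.val < g.val then t g else 0)) else 0)
        = ∑ i ∈ D.J g, if v i then (D.a g i - (if i.val < g.val then t g else 0)) else 0 :=
      sum_congr rfl fun i hi => by rw [huv i hi]
    rw [hc]
    exact D.hJ g u v huv _

/-- the juntas are unchanged. -/
theorem prefixify_J (D : JLinData p n) (t : Fin (n + 1) → ZMod p) (g : Fin (n + 1)) : (prefixify D t).J g = D.J g := rfl

/-- the forms of the re-presentation are prefix counters. -/
theorem prefixify_a (D : JLinData p n) (t : Fin (n + 1) → ZMod p) (g : Fin (n + 1)) :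
    (prefixify D t).a g = fun i => if i.val < g.val then t g else 0 := rfl

/-- **same strategy**: when the forms agree with the prefix counters outside the juntas, the re-presented data plays
exactly the original strategy. -/
theorem prefixify_strat (D : JLinData p n) (t : Fin (n + 1) → ZMod p)
    (ht : ∀ g, ∀ i ∉ D.J g, D.a g i = if i.val < g.val then t g else 0) :
    (prefixify D t).strat = D.strat := by
  funext g u
  show D.h g u ((prefixify D t).form g u + _) = D.h g u (D.form g u)
  congr 1
  unfold JLinData.form
  simp only [prefixify_a]
  have h1 : ∀ i : Fin n, (if u i then D.a g i else (0 : ZMod p))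
      = (if u i then (if i.val < g.val then t g else 0) else 0)
        + (if u i then (D.a g i - (if i.val < g.val then t g else 0)) else 0) := by
    intro i; split_ifs <;> ring
  rw [Finset.sum_congr rfl (fun i _ => h1 i), sum_add_distrib]
  congr 1
  exact Finset.sum_subset (subset_univ (D.J g)) (fun i _ hi => by simp [ht g i hi])

end PrefixFace

section FinalsModJunta

/-- **THE PREFIX FACE MODULO THE JUNTA** (every `p` with `3 ∤ p`): `log₂ n`-junta ⊕ linear-form strategies whose forms are prefix
counters `t_g·𝟙_{[0,g)}` OUTSIDE the read bits `J_g` (arbitrary coefficients on `J_g`) win on at most `θ·2ⁿ` inputs,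
`θ = 1 − 2^{−(4p+2)}`, `n ≥ 2^{6(4p+2)+10}`, every charge. -/
theorem prefixFormModJunta_hard_unif {p : ℕ} (hp : p % 3 ≠ 0) :
    ∃ θ : ℝ, θ < 1 ∧ ∃ n₀ : ℕ, ∀ n ≥ n₀, ∀ (c : ℕ) (D : JLinData p n),
      (∀ g, (D.J g).card ≤ Nat.log 2 n) →
      (∀ g, ∃ t : ZMod p, ∀ i ∉ D.J g, D.a g i = if i.val < g.val then t else 0) →
      (winCount c D.strat : ℝ) ≤ θ * (2 : ℝ) ^ n := by
  obtain ⟨θ, hθ, n₀, H⟩ := prefixForm_hard_unif hp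
  refine ⟨θ, hθ, n₀, fun n hn c D hJ hpre => ?_⟩
  choose t ht using hpre
  have h := H n hn c (PrefixFace.prefixify D t) hJ (fun g => ⟨t g, rfl⟩)
  rwa [PrefixFace.prefixify_strat D t ht] at h

/-- the same for a prime `p ≠ 3`. -/
theorem prefixFormModJunta_hard_unif_prime {p : ℕ} [hpr : Fact p.Prime] (hp3 : p ≠ 3) :
    ∃ θ : ℝ, θ < 1 ∧ ∃ n₀ : ℕ, ∀ n ≥ n₀, ∀ (c : ℕ) (D : JLinData p n),
      (∀ g, (D.J g).card ≤ Nat.log 2 n) →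
      (∀ g, ∃ t : ZMod p, ∀ i ∉ D.J g, D.a g i = if i.val < g.val then t else 0) →
      (winCount c D.strat : ℝ) ≤ θ * (2 : ℝ) ^ n :=
  prefixFormModJunta_hard_unif fun h =>
    hp3 ((Nat.prime_dvd_prime_iff_eq Nat.prime_three hpr.out).mp (Nat.dvd_of_mod_eq_zero h)).symm

end FinalsModJunta

end Summit.QuantumAdvantage.AdviceFreeQNC0.JLinPeel
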